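import Mathlib

/-!
# Route «KPlusLogSqLaw», crux `WeakLifting` (stmt-ValiantsHypothesis-19561) — α row, RESOLVED limit:
# a block has ONE exchange time — envelopes are block-distinct swap chains (g17)

HONEST FRAMING.  Helper lemmas (`--supports stmt-ValiantsHypothesis-19561 --as helper`), seat pub-symmetroid-conjb-2 (g17), cell `pub-symmetroid`,
2026-08-28.  Elementary; def-free; resolved (tropical) limit only; nothing here is a root count and nothing bears on `WeakLifting` / `TropicalB` in
their windows, on Conjecture B (`KPlusLogSqLaw`), on `MatrixDescartes` or on VP ≠ VNP.

CONTENT (paper: HOME/pub-symmetroid-conjb-2/g17/theory/THEORY-NOTE-g17.md §4.8(e)).  Weights `a_k + λ_k t`; exchanging a block `P` in an edge set `μ`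
means passing to `μ ∆ P = (μ \ P) ∪ (P \ μ)`.  The exchange is value-neutral at time `t` iff
`(Σ_{P \ μ} a − Σ_{μ ∩ P} a) + t · (Σ_{P \ μ} λ − Σ_{μ ∩ P} λ) = 0` (`exchange_balance`), an equation that involves only `P` and the PATTERN `μ ∩ P`.
Hence (`block_time_eq`, `block_time_eq'`): if the same block `P` is exchanged value-neutrally at times `t₁` (in `μ`) and `t₂` (in `ν`) with the same or the
complementary pattern and nonzero slope gain, then `t₁ = t₂`.  Along the upper envelope of ONE intercept vector the breakpoint times strictly increase, so
no block is exchanged twice: envelopes are BLOCK-DISTINCT chains — the hypothesis under which conjecture `D^comb` (THEORY-NOTE-g17 §4.8(e); exact for all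
two-speed words with at most 6 edges) bounds the parity-changing exchanges by the number of edges, and exactly the memory that the kernel META NO-GO
(`ResolvedNoStatePotential.no_state_potential_m6`) shows a proof must keep.  [this seat; elementary]
-/

-- `Summit.ValiantsHypothesis.ValiantsHypothesis.…` repeats a component by the D-0017 layout (single-conjunct summit); the name is mandated.
set_option linter.dupNamespace false

namespace Summit.ValiantsHypothesis.ValiantsHypothesis.Theorems.KPlusLogSqLaw.ResolvedBlockTime

open Finset

/-- Sum over a block exchange: `Σ_{(μ \ P) ∪ (P \ μ)} f = Σ_μ f − Σ_{μ ∩ P} f + Σ_{P \ μ} f`. -/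
theorem sum_symmDiff_eq (f : ℕ → ℝ) (μ P : Finset ℕ) :
    ∑ k ∈ μ \ P ∪ P \ μ, f k = ∑ k ∈ μ, f k - ∑ k ∈ μ ∩ P, f k + ∑ k ∈ P \ μ, f k := by
  have hdisj : Disjoint (μ \ P) (P \ μ) :=
    disjoint_left.mpr fun k hk hk' => (mem_sdiff.mp hk).2 (mem_sdiff.mp hk').1
  rw [sum_union hdisj]
  have hsplit : ∑ k ∈ μ, f k = ∑ k ∈ μ \ P, f k + ∑ k ∈ μ ∩ P, f k := by
    rw [← sum_union (disjoint_sdiff_inter μ P), sdiff_union_inter]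
  linarith

/-- EXCHANGE BALANCE.  The exchange `μ ↦ μ ∆ P` is value-neutral at time `t` iff
`(Σ_{P \ μ} a − Σ_{μ ∩ P} a) + t (Σ_{P \ μ} λ − Σ_{μ ∩ P} λ) = 0` — an equation in `P` and the pattern `μ ∩ P` only. -/
theorem exchange_balance (a lam : ℕ → ℝ) (μ P : Finset ℕ) (t : ℝ) :
    (∑ k ∈ μ \ P ∪ P \ μ, (a k + lam k * t) = ∑ k ∈ μ, (a k + lam k * t)) ↔
      (∑ k ∈ P \ μ, a k - ∑ k ∈ μ ∩ P, a k) + t * (∑ k ∈ P \ μ, lam k - ∑ k ∈ μ ∩ P, lam k) = 0 := by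
  rw [sum_symmDiff_eq]
  simp only [sum_add_distrib, ← sum_mul]
  constructor <;> intro h <;> linarith

/-- `P \ μ` depends only on the pattern `μ ∩ P`. -/
theorem sdiff_eq_of_inter_eq (μ ν P : Finset ℕ) (h : μ ∩ P = ν ∩ P) : P \ μ = P \ ν := by
  ext k
  simp only [mem_sdiff]
  constructor
  · rintro ⟨hkP, hkμ⟩
    refine ⟨hkP, fun hkν => hkμ ?_⟩
    have : k ∈ ν ∩ P := mem_inter.mpr ⟨hkν, hkP⟩
    rw [← h] at this; exact (mem_inter.mp this).1
  · rintro ⟨hkP, hkν⟩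
    refine ⟨hkP, fun hkμ => hkν ?_⟩
    have : k ∈ μ ∩ P := mem_inter.mpr ⟨hkμ, hkP⟩
    rw [h] at this; exact (mem_inter.mp this).1

/-- ONE TIME PER BLOCK (same pattern).  If the block `P` is exchanged value-neutrally at time `t₁` in `μ` and at time `t₂` in `ν`, with the same
pattern `μ ∩ P = ν ∩ P` and nonzero slope gain, then `t₁ = t₂`. -/
theorem block_time_eq (a lam : ℕ → ℝ) (μ ν P : Finset ℕ) (t₁ t₂ : ℝ) (hpat : μ ∩ P = ν ∩ P)
    (hg : ∑ k ∈ P \ μ, lam k - ∑ k ∈ μ ∩ P, lam k ≠ 0)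
    (h₁ : ∑ k ∈ μ \ P ∪ P \ μ, (a k + lam k * t₁) = ∑ k ∈ μ, (a k + lam k * t₁))
    (h₂ : ∑ k ∈ ν \ P ∪ P \ ν, (a k + lam k * t₂) = ∑ k ∈ ν, (a k + lam k * t₂)) : t₁ = t₂ := by
  rw [exchange_balance] at h₁ h₂
  rw [← sdiff_eq_of_inter_eq μ ν P hpat, ← hpat] at h₂
  have hmul : (t₁ - t₂) * (∑ k ∈ P \ μ, lam k - ∑ k ∈ μ ∩ P, lam k) = 0 := by linarith
  rcases mul_eq_zero.mp hmul with h | h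
  · linarith
  · exact absurd h hg

/-- ONE TIME PER BLOCK (complementary pattern).  Same conclusion when `ν` carries the complementary pattern `ν ∩ P = P \ μ`
(the reverse exchange of the same block): the balance equation is the negative of the one for `μ`. -/
theorem block_time_eq' (a lam : ℕ → ℝ) (μ ν P : Finset ℕ) (t₁ t₂ : ℝ) (hpat : ν ∩ P = P \ μ)
    (hg : ∑ k ∈ P \ μ, lam k - ∑ k ∈ μ ∩ P, lam k ≠ 0)
    (h₁ : ∑ k ∈ μ \ P ∪ P \ μ, (a k + lam k * t₁) = ∑ k ∈ μ, (a k + lam k * t₁))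
    (h₂ : ∑ k ∈ ν \ P ∪ P \ ν, (a k + lam k * t₂) = ∑ k ∈ ν, (a k + lam k * t₂)) : t₁ = t₂ := by
  rw [exchange_balance] at h₁ h₂
  have hsd : P \ ν = μ ∩ P := by
    ext k
    simp only [mem_sdiff, mem_inter]
    constructor
    · rintro ⟨hkP, hkν⟩
      refine ⟨?_, hkP⟩
      by_contra hkμ
      have : k ∈ P \ μ := mem_sdiff.mpr ⟨hkP, hkμ⟩
      rw [← hpat] at this; exact hkν (mem_inter.mp this).1
    · rintro ⟨hkμ, hkP⟩
      refine ⟨hkP, fun hkν => ?_⟩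
      have : k ∈ ν ∩ P := mem_inter.mpr ⟨hkν, hkP⟩
      rw [hpat] at this; exact (mem_sdiff.mp this).2 hkμ
  rw [hsd, hpat] at h₂
  have hmul : (t₁ - t₂) * (∑ k ∈ P \ μ, lam k - ∑ k ∈ μ ∩ P, lam k) = 0 := by linarith
  rcases mul_eq_zero.mp hmul with h | h
  · linarith
  · exact absurd h hg

end Summit.ValiantsHypothesis.ValiantsHypothesis.Theorems.KPlusLogSqLaw.ResolvedBlockTime
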